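import Summits.CriticalPhenomena.PercolationContinuityZ3.Theorems.Transplant.FKConnectivityAllQK5DisjCert1
import HarnessLib

/-!
# `K₅` is Potts–Rayleigh (`0 < q ≤ 1`), disjoint pairs — certificate data, slice 1 (part b: fibers `J ≥ 128`, packaging)

Helper file (`--supports stmt-CriticalPhenomena-4575`), FK sub-lane `prim-bschramm-fk-3` (gen 11) of the post-continuity programme;
builds on p205010 (kernel theorem, internal audit signed; external expert review pending).  No named facts, no sorries; standard axioms.

THE THEOREM OF THIS CHAIN (`…K5Disj`): **`K₅` is Potts–Rayleigh for every `0 < q ≤ 1`** — the random-cluster measure `φ_{w,q}` on every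
weighted graph with at most five vertices is edge-negatively associated, `φ(J_e ∩ J_f) ≤ φ(J_e)φ(J_f)` for ALL pairs `e ≠ f` (adjacent pairs:
gen 10, `…K5`; this chain: the disjoint pairs, one `S₅`-orbit, `(e, f) = (01, 23)`).  Wagner 2008, Ex. 5.2 records Sokal's computation for
`K₄`; for `K₅` the Rayleigh difference `Z¹⁰Z⁰¹ − Z⁰⁰Z¹¹` of `(01, 23)` has negative coefficients that no binomial (AM–GM) square repairs
(gen 10, LP scoping), so the certificate is a SUM OF GRAM SQUARES: with `y` the odds parameters of the eight pairs `E₈' = K₅ − {01, 23}`,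
the reduced difference `D̂ = (Z¹⁰Z⁰¹ − Z⁰⁰Z¹¹)/(q²(1−q))` (degree `4` in `q`) is written in the scaled Bernstein basis
`Σ_{j ≤ 4} B̃_j(y) q^j (1−q)^{4−j}`, and each slice `B̃_j` is certified `≥ 0` on the orthant as
`B̃_j = Σ_T y^T · m_Tᵀ H_{T,j} m_T + (nonnegative coefficients)`, `|T| ≤ 2`, `m_T` the multi-affine monomials off `T` inside the
Newton polytope, `H_{T,j} = U K Uᵀ` integer positive semidefinite (witness `s²K = LLᵀ + E`, `E` diagonally dominant).  The certificates
were found by semidefinite programming, facial reduction and integer rounding OUTSIDE Lean (bschramm/FK-BARRIER.md §15) and are CHECKED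
HERE BY THE KERNEL (`decide +kernel`), fiber by fiber (`3^8 = 6561` fibers per slice).
[cite: Wagner2006, Ex. 5.2, Conj. 5.3, Thm. 5.8 (p. 13)] [cite: Grimmett2006, §3.9 eq. (3.94), Conj. (3.96) (pp. 63–66); §1.4 eq. (1.20) (p. 15)]

THIS FILE: the scaled-Bernstein slice `j = 1` of `D̂` — its certificate as packed naturals (`K5D.cert1`, scale `K5D.cert1Den`) and the
KERNEL CHECKS by `decide +kernel`: `blockOK` on every block (structure, `H = U K Uᵀ`, PSD witness) and `checkFibers` on the fibers
`I ⊆ J` in shards of `32` values of `J` (each shard ≲ 1 min of kernel time; `maxHeartbeats 0` as in the tree's other kernel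
certificates).  The same inequalities were verified outside Lean by an independent integer re-implementation (0 violations on all
`6561` fibers).  Packaged as `K5D.sliceCertified_one : SliceCertified 1` (in the `…b` half for the split slices).
-/

namespace Summit.CriticalPhenomena.PercolationContinuityZ3.Theorems

namespace FK

namespace K5D

set_option maxHeartbeats 0 in
/-- fiber shard 4 of slice 1: `checkFibers` on `128 ≤ J < 160` (kernel computation). [folklore] -/
theorem cert1_fibers_4 : checkFibers 1 cert1Den cert1 (32 * 4) 32 = true := by
  decide +kernel

set_option maxHeartbeats 0 in
/-- fiber shard 5 of slice 1: `checkFibers` on `160 ≤ J < 192` (kernel computation). [folklore] -/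
theorem cert1_fibers_5 : checkFibers 1 cert1Den cert1 (32 * 5) 32 = true := by
  decide +kernel

set_option maxHeartbeats 0 in
/-- fiber shard 6 of slice 1: `checkFibers` on `192 ≤ J < 224` (kernel computation). [folklore] -/
theorem cert1_fibers_6 : checkFibers 1 cert1Den cert1 (32 * 6) 32 = true := by
  decide +kernel

set_option maxHeartbeats 0 in
/-- fiber shard 7 of slice 1: `checkFibers` on `224 ≤ J < 256` (kernel computation). [folklore] -/
theorem cert1_fibers_7 : checkFibers 1 cert1Den cert1 (32 * 7) 32 = true := by
  decide +kernel

/-- **slice 1 of the `K₅` disjoint-pair certificate is certified** (blocks + all `6561` fibers, kernel-checked). [folklore] -/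
theorem sliceCertified_one : SliceCertified 1 :=
  sliceCertified_of_shards (j := 1) (den := cert1Den) (cert := cert1) (by decide) cert1_blocks (fun k hk =>
    match k, hk with
    | 0, _ => cert1_fibers_0
    | 1, _ => cert1_fibers_1
    | 2, _ => cert1_fibers_2
    | 3, _ => cert1_fibers_3
    | 4, _ => cert1_fibers_4
    | 5, _ => cert1_fibers_5
    | 6, _ => cert1_fibers_6
    | 7, _ => cert1_fibers_7
    | _ + 8, hk => absurd hk (by omega))

end K5D

end FK

end Summit.CriticalPhenomena.PercolationContinuityZ3.Theorems
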